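import Summits.BirchSwinnertonDyer.BirchSwinnertonDyer.Theorems.ManinLocalTwoThreeManinOddAtFourOfCDT
import Summits.BirchSwinnertonDyer.BirchSwinnertonDyer.Theorems.EdixhovenFibreFiveSevenStarredOptimalManinUnitFiveSevenCdtThm1
import HarnessLib

set_option autoImplicit false
-- the sub-problem namespace `Summit.BirchSwinnertonDyer.BirchSwinnertonDyer` duplicates a component by design (D-0017)
set_option linter.dupNamespace false

/-!
# Route ManinLocalTwoThree, crux C2 `ManinOddAtFour` (stmt-BirchSwinnertonDyer-22967), closed by name

C2: granted the route's four printed-fact binders (Mazur 1978 Cor. 4.1, Abbes–Ullmo 1996 Thm. A, Česnavičius 2018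
Thm. 1.2, modularity `exists_isNewformOf` — all IDLE here), for every globally minimal `W/ℚ` and every lattice-optimal
`X₀(N)`-datum `D` (`Λ_W = c · Λ_f`) at a level with `4 ∣ N`: `2 ∤ c₀(D)`.

The landed conditional closer of record `maninLocalTwoThree_maninOddAtFour_of_CDT` (cell bsd-f2-manin, LEAD seat
manin23-p1, p766825; Kummer-diamond / index-four road: the integer `c`-division chain `Λ₁(f) ⊆ Λ_W` from unbounded
denominators, Stevens' cusp-invariance Galois action `StevensGalois.optimalGamma1Parametrization_cuspInv_galoisAction_holds`
discharged in the tree, and the exclusion of the index-four configuration `Λ₁ = 2Λ₀` at `4 ∣ N`) takes exactly the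
printed Calegari–Dimitrov–Tang Theorem 1.0.1 (`Literature.NumberTheory.Automorphic.CalegariDimitrovTang2025_unboundedDenominators`,
as vendored: the holomorphic-at-cusps integer-coefficient special case) as hypothesis; that hypothesis is the tree theorem
`calegariDimitrovTang2025_unboundedDenominators_holds` (p826028, line `cdt_thm1` of crux K★ of route EdixhovenFibreFiveSeven,
cell bsd-wall: CDT Cor. 4.5.3 in invariant form for all levels, Ihara amalgam + congruence-subgroup property, Prop. 3.0.1,
(4.3.3), rationality).  Composing the two proves the item BY NAME, exactly as C3 (p827059) and C5 (p827060) were closed.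

DEPENDENCY AND WORDING OF RECORD (director-bsd (849)(4), (853)(1)).  This file depends on
`calegariDimitrovTang2025_unboundedDenominators_holds` — the in-tree unbounded-denominators (UDC) term.  Status of the
result: PROVED AS TYPED (kernel; axioms `propext`, `Classical.choice`, `Quot.sound`); UDC-DEPENDENT; lean4checker replay and
external expert read PENDING (audit (P†)).  It is NOT an announcement: Manin's conjecture is not claimed proved by this
file — the route's deciding theorem still takes the support `PrintedSemistableManinFacts` (four cite-only printed facts) —
and BSD is not proved by this.
[cite: CalegariDimitrovTang2025, Thm. 1.0.1] [cite: Stevens1982, §1.3 Thm. 1.3.1 (b) (p. 13)]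
-/

namespace Summit.BirchSwinnertonDyer.BirchSwinnertonDyer.Theorems

/-- **Crux C2 `ManinOddAtFour` (stmt-BirchSwinnertonDyer-22967), proved by name**: `2 ∤ c₀` at every lattice-optimal
`X₀(N)`-datum of a globally minimal curve when `4 ∣ N` — from CDT Theorem 1.0.1 as vendored
(`calegariDimitrovTang2025_unboundedDenominators_holds`, the in-tree UDC term) through the LEAD's conditional closer
`maninLocalTwoThree_maninOddAtFour_of_CDT`; the four printed-fact binders are idle.  PROVED AS TYPED, UDC-DEPENDENT,
audit (P†) pending; Manin's conjecture and BSD are NOT proved by this.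
[cite: CalegariDimitrovTang2025, Thm. 1.0.1] [cite: Stevens1982, §1.3 Thm. 1.3.1 (b) (p. 13)] -/
theorem ManinLocalTwoThree.ManinOddAtFour_proof :
    Summit.BirchSwinnertonDyer.BirchSwinnertonDyer.Theses.ManinLocalTwoThree.ManinOddAtFour :=
  maninLocalTwoThree_maninOddAtFour_of_CDT calegariDimitrovTang2025_unboundedDenominators_holds

end Summit.BirchSwinnertonDyer.BirchSwinnertonDyer.Theorems
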